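import Summits.HodgeConjecture.HodgeConjecture.Theorems.F0P3cStCharTSUpEval               -- ★ (F0P3-p02 (g20)) UP-EVAL: `finsum_upSummand_eq_sum`, `upSummand_eq_of_isLocalStablyConjH`, `up_eq_sum_of_transversal`, the (UP-DEF) currency, `exists_finset_normFibre`
import Summits.HodgeConjecture.HodgeConjecture.Theorems.F0P3cStCharTSUpTrCartanFields     -- ★ p852366 (H3b) CARTAN-FIELDS-H (LH4-p01 (g8)): `centralizer_eq_cartan_of_isLocalGRegular`
import Summits.HodgeConjecture.HodgeConjecture.Theorems.F0P3cStCharTSUpTrWeylFinH         -- ★ p852373 (H3a) WEYL-FIN-H (F0P3a-p01 (g22)): `index_centralizer_subgroupOf_normalizer_ne_zero`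
import Literature.GroupTheory.StableFibreWeightedCount                                    -- ★ p852404 (N5) CLAIM-P ABSTRACT (F0P3-p02 (g23)): `StableFibre.weighted_fibre_sum_eq`
import Literature.GroupTheory.CentralizerConjugatesTorsor                                 -- ★ p852394 (H6-T) TORSOR (LH4-p01 (g8)): `exists_finset_mem_isConj_card_eq_index`
import Literature.NumberTheory.Rogawski1990.UnitFundamentalLemmaInertLeviClause           -- ★ `isLocalGRegular_conj_iff`
import Literature.NumberTheory.Rogawski1990.GRegularLocalisation                           -- ★ `isLocalGRegular_of_isConj`
import HarnessLib

/-!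
# F0 · P3c · crux H413 — ROAD «UP-TR», brick (P3) «CLAIM-P AT THE DATUM»: the stable norm fibre of `g ∈ U(Φ₃)(L⁺_v)` re-parametrised by the Cartan subgroups of
# `H_v = U(Φ₂)(L⁺_v) × U(Φ₁)(L⁺_v)` — (A-2) of the road, [Rogawski1990, §12.5 p. 182 («the number of `ν ∈ 𝔇(T∕F)` …»), Lemma 12.5.1 p. 183]

Cell `pub/hodgecm-mathlib`, crux H413 = `stmt-HodgeConjecture-24833` (lane `--supports`, helper, count-neutral), route HCCMUnconditional; seat F0P3a-p06 (g22); ROAD «UP-TR» (holder ∕ dealer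
F0P3-p02 (g23), board `F0/P3/F0P3-p02/g23/ROAD-UP-TR.v2.F0P3p02g23.md` §A (A-2), DEAL #3h (P3)).  THEOREMS ONLY (no definition ∕ instance ∕ notation ∕ named fact ∕ `sorry`); ★-only imports;
axioms TRIO.

WHAT.  The (UP-DEF) field equation of the adjoint transfer `α ↦ α^G` [Rogawski1990 p. 183] reads, at a regular `g ∈ G = U(Φ₃)(L⁺_v)`,
`up α g = D_G(g)⁻¹ · ∑ᶠ_{q} 𝟙[q.out G-regular, ι(q.out) ↔ g] · F_g(q.out)`, `F_g(s) := τ(s)·D_H(s)·κ(s,g)·α(s)` (★ UP-EVAL: `= D_G(g)⁻¹ · Σ_{t ∈ S} F_g(t)` over ANY transversal `S` of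
the stable norm fibre of `g`).  (A-2) CLAIM-P re-parametrises that finite sum by the H-CARTAN SUBGROUPS: for a complete irredundant system `SH` of Cartan subgroups `T = Z_H(γ₀)` of `H_v`
(★ (H1) `exists_cartanAllH_classShape`'s letters, BY SHAPE here), «embeddings» `ψ T i : H_v → G` (`i : Fin (n T)`) matching every `G`-regular `s ∈ T` to its norm partners with EXACTLY
ONE `ψ T i s ∼ g'` per partner (★ (N2b′) EMB-FAMILY's letters, BY SHAPE), and class counts `m T` (the stable class of a `G`-regular `s ∈ T` has `m T` conjugacy classes — ★ (H6a′)
TWIST-MAPS' letters, BY SHAPE):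

  **`∑ᶠ_{q} 𝟙[…]·F_g(q.out) = Σ_{T ∈ SH} [N_H(T):T]⁻¹ · (m T)⁻¹ · Σ_i Σ_{s ∈ T G-regular, ψ T i s ∼ g} F_g(s)`**   (`finsum_upSummand_eq_weightedSum`),

and the DATUM DRESS `𝔇.up α g = D_G(g)⁻¹ · (the right-hand side)` under UP-EVAL's pins (`up_eq_weightedSum`).  This is ONE `exact` of the ★ ABSTRACT count
`Literature.GroupTheory.StableFibre.weighted_fibre_sum_eq` (N5) at `st := IsLocalStablyConjH L v`, `reg := IsLocalGRegular L v`, `R := IsLocalNormPair L (qsForm L) v`,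
`idx T := (T.subgroupOf (Subgroup.normalizer ↑T)).index`, with its TEN structural hypotheses DISCHARGED BY NAME: the six relation axioms (★ `IsStablyConjH.refl ∕ symm ∕ trans`,
★ `isStablyConjH_of_isConj`, ★ `isLocalGRegular_of_isLocalStablyConjH`, ★ `isLocalNormPair_iff_of_isLocalStablyConjH`, conjugation on the right inside `GL₃`), the TORSOR count
(★ (H6-T) `exists_finset_mem_isConj_card_eq_index` over ★ (H3b) `centralizer_eq_cartan_of_isLocalGRegular`, ★ `isLocalGRegular_conj_iff`, ★ (H3a) `index_centralizer_subgroupOf_normalizer_ne_zero`),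
the transversal `Q` (★ `exists_finset_normFibre`) and the stability of `F_g` on `G`-regular classes (★ UP-EVAL `upSummand_eq_of_isLocalStablyConjH`, extended by `0` off the fibre so that
(N5)'s unconditional `hF` holds).  LEFT BY SHAPE (road letters, token for token in (N5)'s binders): `SH` with `hZ ∕ hcomplete ∕ hirred` ((H1)), `m ∕ hclasses` ((H6a′)),
`n ψ hψR hψuniq fib hfib` ((N2b′)).

HONEST LABEL: count-neutral; block consequents 11 → 10 → 9 only at the rider editions; organs 2 = 2; h413 registry untouched; HC_CM is proved only modulo the printed citations until rung 0
closes.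

## References
* [Rogawski1990] J. D. Rogawski, *Automorphic Representations of Unitary Groups in Three Variables*, Ann. of Math. Stud. 123 (1990), §3.5–3.6 pp. 28–31; §4.9 p. 55; §12.5 pp. 182–183
  (the count «`|Ω(T,G)|⁻¹|Ω_F(T,G)|`», Lemma 12.5.1).
* [LanglandsShelstad1987] R. P. Langlands, D. Shelstad, *On the definition of transfer factors*, Math. Ann. 278 (1987), §1.3.
* [HarishChandra1970] Harish-Chandra, *Harmonic analysis on reductive p-adic groups*, LNM 162 (1970), Lemma 42.
-/

set_option autoImplicit false
-- the mandated namespace has the single-problem summit's repeated segment (`HodgeConjecture.HodgeConjecture`)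
set_option linter.dupNamespace false

noncomputable section

open NumberField IsDedekindDomain
open scoped Matrix MatrixGroups Classical
open Literature.NumberTheory.Rogawski1990 Literature.NumberTheory.Automorphic Literature.NumberTheory.Automorphic.UnitaryGroup
open Literature.NumberTheory.GaloisRepresentations
open Summit.HodgeConjecture.HodgeConjecture.Cruxes.H413.F0P3cStCharTSUpEval

namespace Summit.HodgeConjecture.HodgeConjecture.Cruxes.H413.F0P3cStCharTSUpTrClaimP

variable (L : Type) [Field L] [NumberField L] [IsCMField L] (v : HeightOneSpectrum (𝓞 ↥(maximalRealSubfield L)))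

/-! ## §1 The two relation facts (N5) reads that are not yet named in the tree -/

/-- **Matching is invariant under conjugation of the `G`-side partner**: `ι_v(γ_H) ↔ g`, `g ∼ g'` in `U(Φ₃)(L⁺_v)` ⇒ `ι_v(γ_H) ↔ g'` (matching IS conjugacy of `ι_v(γ_H)` with `g` in
`GL₃(∏_{w ∣ v} L_w)`, ★ `Corresponds`). [cite: Rogawski1990, §4.9 p. 54; §3.1 p. 19] -/
theorem isLocalNormPair_of_isConj_right
    (a : (UnitaryGroup.cmDatum L 2 (Matrix.of fun i j : Fin 2 => if i.val + j.val + 1 = 2 then (1 : L) else 0)).Local v ×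
      (UnitaryGroup.cmDatum L 1 (Matrix.of fun i j : Fin 1 => if i.val + j.val + 1 = 1 then (1 : L) else 0)).Local v)
    {g g' : Gqs L v} (hgg' : IsConj g g') (h : IsLocalNormPair L (qsForm L) v a g) : IsLocalNormPair L (qsForm L) v a g' := by
  obtain ⟨c, hc⟩ := isConj_iff.1 hgg'
  have hval : (c : Gqs L v).val * g.val * ((c : Gqs L v).val)⁻¹ = g'.val := by
    rw [← hc]; rfl
  exact IsConj.trans h (isConj_iff.2 ⟨(c : Gqs L v).val, hval⟩)

/-- **The TORSOR count at a Cartan subgroup `T = Z_H(γ₀)` of `H_v`** (`γ₀` `G`-regular, `v` non-split): for every `G`-regular `s ∈ T` there is a `Finset` `A` with `x ∈ A ↔ x ∈ T ∧ s ∼_H x`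
and `A.card = [N_H(T) : T]` — ★ (H6-T) `exists_finset_mem_isConj_card_eq_index` with its three inputs discharged by ★ (H3b) `centralizer_eq_cartan_of_isLocalGRegular`, ★ `isLocalGRegular_conj_iff`,
★ (H3a) `index_centralizer_subgroupOf_normalizer_ne_zero`; the `htorsor` binder of ★ (N5). [cite: Rogawski1990, §12.5 p. 182] [cite: HarishChandra1970, Lemma 42] -/
theorem exists_finset_mem_isConj_card_eq_index_centralizerH (hns : ∀ w : PlacesOver L v, IsCMField.complexConj L • w.1 = w.1)
    {T : Subgroup ((UnitaryGroup.cmDatum L 2 (Matrix.of fun i j : Fin 2 => if i.val + j.val + 1 = 2 then (1 : L) else 0)).Local v ×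
      (UnitaryGroup.cmDatum L 1 (Matrix.of fun i j : Fin 1 => if i.val + j.val + 1 = 1 then (1 : L) else 0)).Local v)}
    {γ₀ : (UnitaryGroup.cmDatum L 2 (Matrix.of fun i j : Fin 2 => if i.val + j.val + 1 = 2 then (1 : L) else 0)).Local v ×
      (UnitaryGroup.cmDatum L 1 (Matrix.of fun i j : Fin 1 => if i.val + j.val + 1 = 1 then (1 : L) else 0)).Local v}
    (hγ₀ : IsLocalGRegular L v γ₀)
    (hT : T = Subgroup.centralizer ({γ₀} : Set ((UnitaryGroup.cmDatum L 2 (Matrix.of fun i j : Fin 2 => if i.val + j.val + 1 = 2 then (1 : L) else 0)).Local v ×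
      (UnitaryGroup.cmDatum L 1 (Matrix.of fun i j : Fin 1 => if i.val + j.val + 1 = 1 then (1 : L) else 0)).Local v)))
    {s : (UnitaryGroup.cmDatum L 2 (Matrix.of fun i j : Fin 2 => if i.val + j.val + 1 = 2 then (1 : L) else 0)).Local v ×
      (UnitaryGroup.cmDatum L 1 (Matrix.of fun i j : Fin 1 => if i.val + j.val + 1 = 1 then (1 : L) else 0)).Local v}
    (hs : s ∈ T) (hreg : IsLocalGRegular L v s) :
    ∃ A : Finset ((UnitaryGroup.cmDatum L 2 (Matrix.of fun i j : Fin 2 => if i.val + j.val + 1 = 2 then (1 : L) else 0)).Local v ×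
        (UnitaryGroup.cmDatum L 1 (Matrix.of fun i j : Fin 1 => if i.val + j.val + 1 = 1 then (1 : L) else 0)).Local v),
      (∀ x, x ∈ A ↔ x ∈ T ∧ IsConj s x) ∧
      A.card = (T.subgroupOf (Subgroup.normalizer (T : Set ((UnitaryGroup.cmDatum L 2 (Matrix.of fun i j : Fin 2 => if i.val + j.val + 1 = 2 then (1 : L) else 0)).Local v ×
        (UnitaryGroup.cmDatum L 1 (Matrix.of fun i j : Fin 1 => if i.val + j.val + 1 = 1 then (1 : L) else 0)).Local v)))).index := by
  have hW : (T.subgroupOf (Subgroup.normalizer (T : Set ((UnitaryGroup.cmDatum L 2 (Matrix.of fun i j : Fin 2 => if i.val + j.val + 1 = 2 then (1 : L) else 0)).Local v ×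
      (UnitaryGroup.cmDatum L 1 (Matrix.of fun i j : Fin 1 => if i.val + j.val + 1 = 1 then (1 : L) else 0)).Local v)))).index ≠ 0 := by
    rw [hT]
    exact F0P3cStCharTSUpTrWeylFinH.index_centralizer_subgroupOf_normalizer_ne_zero L v hns γ₀ hγ₀
  exact Literature.GroupTheory.exists_finset_mem_isConj_card_eq_index T
    {x | IsLocalGRegular L v x} (fun t ht => F0P3cStCharTSUpTrCartanFields.centralizer_eq_cartan_of_isLocalGRegular hγ₀ hT t ht)
    (fun g x hx => (isLocalGRegular_conj_iff L g x).2 hx) hW hs hreg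

/-! ## §2 CLAIM-P: the (UP-DEF) finite sum over the stable norm fibre, re-parametrised by the H-Cartan subgroups -/

section ClaimP

variable (hns : ∀ w : PlacesOver L v, IsCMField.complexConj L • w.1 = w.1) (μ : HeckeCharacter L)
  -- the `D_H`-weight and the class function `α`: stable on `G`-regular classes (UP-EVAL's currency)
  (DH : (UnitaryGroup.cmDatum L 2 (Matrix.of fun i j : Fin 2 => if i.val + j.val + 1 = 2 then (1 : L) else 0)).Local v ×
      (UnitaryGroup.cmDatum L 1 (Matrix.of fun i j : Fin 1 => if i.val + j.val + 1 = 1 then (1 : L) else 0)).Local v → ℝ)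
  (hDHst : ∀ a b, IsLocalGRegular L v a → IsLocalStablyConjH L v a b → DH b = DH a)
  (α : (UnitaryGroup.cmDatum L 2 (Matrix.of fun i j : Fin 2 => if i.val + j.val + 1 = 2 then (1 : L) else 0)).Local v ×
      (UnitaryGroup.cmDatum L 1 (Matrix.of fun i j : Fin 1 => if i.val + j.val + 1 = 1 then (1 : L) else 0)).Local v → ℂ)
  (hαst : ∀ a b, IsLocalGRegular L v a → IsLocalStablyConjH L v a b → α b = α a)
  -- (H1) CARTAN-ALL-H letters, BY SHAPE (★ `exists_cartanAllH_classShape` clauses 2, 4, 5)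
  (SH : Finset (Subgroup ((UnitaryGroup.cmDatum L 2 (Matrix.of fun i j : Fin 2 => if i.val + j.val + 1 = 2 then (1 : L) else 0)).Local v ×
      (UnitaryGroup.cmDatum L 1 (Matrix.of fun i j : Fin 1 => if i.val + j.val + 1 = 1 then (1 : L) else 0)).Local v)))
  (hZ : ∀ T ∈ SH, ∃ γ₀ : (UnitaryGroup.cmDatum L 2 (Matrix.of fun i j : Fin 2 => if i.val + j.val + 1 = 2 then (1 : L) else 0)).Local v ×
      (UnitaryGroup.cmDatum L 1 (Matrix.of fun i j : Fin 1 => if i.val + j.val + 1 = 1 then (1 : L) else 0)).Local v,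
    IsLocalGRegular L v γ₀ ∧ T = Subgroup.centralizer ({γ₀} : Set ((UnitaryGroup.cmDatum L 2 (Matrix.of fun i j : Fin 2 => if i.val + j.val + 1 = 2 then (1 : L) else 0)).Local v ×
      (UnitaryGroup.cmDatum L 1 (Matrix.of fun i j : Fin 1 => if i.val + j.val + 1 = 1 then (1 : L) else 0)).Local v)))
  (hcomplete : ∀ h : (UnitaryGroup.cmDatum L 2 (Matrix.of fun i j : Fin 2 => if i.val + j.val + 1 = 2 then (1 : L) else 0)).Local v ×
      (UnitaryGroup.cmDatum L 1 (Matrix.of fun i j : Fin 1 => if i.val + j.val + 1 = 1 then (1 : L) else 0)).Local v,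
    IsLocalGRegular L v h → ∃ T ∈ SH, ∃ s ∈ T, IsConj h s)
  (hirred : ∀ T ∈ SH, ∀ T' ∈ SH, ∀ s ∈ T, ∀ s' ∈ T', IsLocalGRegular L v s → IsConj s s' → T = T')
  -- (H6a′) TWIST-MAPS ∕ (N2b′) EMB-FAMILY letters, BY SHAPE (★ (N5)'s binders at the datum)
  (m n : Subgroup ((UnitaryGroup.cmDatum L 2 (Matrix.of fun i j : Fin 2 => if i.val + j.val + 1 = 2 then (1 : L) else 0)).Local v ×
      (UnitaryGroup.cmDatum L 1 (Matrix.of fun i j : Fin 1 => if i.val + j.val + 1 = 1 then (1 : L) else 0)).Local v) → ℕ)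
  (ψ : (T : Subgroup ((UnitaryGroup.cmDatum L 2 (Matrix.of fun i j : Fin 2 => if i.val + j.val + 1 = 2 then (1 : L) else 0)).Local v ×
      (UnitaryGroup.cmDatum L 1 (Matrix.of fun i j : Fin 1 => if i.val + j.val + 1 = 1 then (1 : L) else 0)).Local v)) → Fin (n T) →
    ((UnitaryGroup.cmDatum L 2 (Matrix.of fun i j : Fin 2 => if i.val + j.val + 1 = 2 then (1 : L) else 0)).Local v ×
      (UnitaryGroup.cmDatum L 1 (Matrix.of fun i j : Fin 1 => if i.val + j.val + 1 = 1 then (1 : L) else 0)).Local v) → Gqs L v)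
  (hclasses : ∀ T ∈ SH, ∀ s ∈ T, IsLocalGRegular L v s →
    ∃ C : Finset ((UnitaryGroup.cmDatum L 2 (Matrix.of fun i j : Fin 2 => if i.val + j.val + 1 = 2 then (1 : L) else 0)).Local v ×
        (UnitaryGroup.cmDatum L 1 (Matrix.of fun i j : Fin 1 => if i.val + j.val + 1 = 1 then (1 : L) else 0)).Local v),
      (∀ x ∈ C, IsLocalStablyConjH L v s x) ∧ (∀ x ∈ C, ∀ y ∈ C, IsConj x y → x = y) ∧ (∀ y, IsLocalStablyConjH L v s y → ∃ x ∈ C, IsConj y x) ∧ C.card = m T)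
  (hψR : ∀ T ∈ SH, ∀ (i : Fin (n T)), ∀ s ∈ T, IsLocalGRegular L v s → IsLocalNormPair L (qsForm L) v s (ψ T i s))
  (hψuniq : ∀ T ∈ SH, ∀ s ∈ T, IsLocalGRegular L v s → ∀ g : Gqs L v, IsLocalNormPair L (qsForm L) v s g → ∃! i : Fin (n T), IsConj (ψ T i s) g)
  (g : Gqs L v)
  (fib : (T : Subgroup ((UnitaryGroup.cmDatum L 2 (Matrix.of fun i j : Fin 2 => if i.val + j.val + 1 = 2 then (1 : L) else 0)).Local v ×
      (UnitaryGroup.cmDatum L 1 (Matrix.of fun i j : Fin 1 => if i.val + j.val + 1 = 1 then (1 : L) else 0)).Local v)) → Fin (n T) →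
    Finset ((UnitaryGroup.cmDatum L 2 (Matrix.of fun i j : Fin 2 => if i.val + j.val + 1 = 2 then (1 : L) else 0)).Local v ×
      (UnitaryGroup.cmDatum L 1 (Matrix.of fun i j : Fin 1 => if i.val + j.val + 1 = 1 then (1 : L) else 0)).Local v))
  (hfib : ∀ T ∈ SH, ∀ (i : Fin (n T)), ∀ x, x ∈ fib T i ↔ x ∈ T ∧ IsLocalGRegular L v x ∧ IsConj (ψ T i x) g)

include hns hDHst hαst hZ hcomplete hirred hclasses hψR hψuniq hfib in
/-- **(P3) CLAIM-P AT THE DATUM — (A-2).**  At every `g ∈ U(Φ₃)(L⁺_v)` (non-split `v`), for `D_H` and `α` stable on `G`-regular classes of `H_v`, with the (H1) ∕ (H6a′) ∕ (N2b′) letters BY SHAPE: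
`∑ᶠ_{q : stable classes of H_v} 𝟙[q.out G-regular ∧ ι(q.out) ↔ g] · τ(q.out)·D_H(q.out)·κ(q.out, g)·α(q.out)`
`= Σ_{T ∈ SH} ([N_H(T):T] : ℂ)⁻¹ · (m T : ℂ)⁻¹ · Σ_{i : Fin (n T)} Σ_{x ∈ fib T i} τ(x)·D_H(x)·κ(x, g)·α(x)`
— ★ (N5) `StableFibre.weighted_fibre_sum_eq` at `(IsLocalStablyConjH, IsLocalGRegular, IsLocalNormPair)` with its structural hypotheses discharged by name (module docstring), the
transversal from ★ `exists_finset_normFibre`, the left side through ★ UP-EVAL `finsum_upSummand_eq_sum`. [cite: Rogawski1990, §12.5 pp. 182–183, Lemma 12.5.1]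
[cite: LanglandsShelstad1987, §1.3] -/
theorem finsum_upSummand_eq_weightedSum :
    ∑ᶠ q : Quot (IsLocalStablyConjH L v),
        (if IsLocalGRegular L v q.out ∧ IsLocalNormPair L (qsForm L) v q.out g then
          finTau L v q.out μ * (DH q.out : ℂ) * ((finKappaAt L v (qsForm L) q.out g : ℤ) : ℂ) * α q.out
        else 0) =
      ∑ T ∈ SH, (((T.subgroupOf (Subgroup.normalizer (T : Set ((UnitaryGroup.cmDatum L 2 (Matrix.of fun i j : Fin 2 => if i.val + j.val + 1 = 2 then (1 : L) else 0)).Local v ×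
          (UnitaryGroup.cmDatum L 1 (Matrix.of fun i j : Fin 1 => if i.val + j.val + 1 = 1 then (1 : L) else 0)).Local v)))).index : ℂ)⁻¹ * ((m T : ℂ))⁻¹) *
        ∑ i : Fin (n T), ∑ x ∈ fib T i, finTau L v x μ * (DH x : ℂ) * ((finKappaAt L v (qsForm L) x g : ℤ) : ℂ) * α x := by
  -- the transversal of the stable norm fibre of `g`
  obtain ⟨Q, hQ, hQpair, hQexh⟩ := exists_finset_normFibre L (qsForm L) v g
  rw [finsum_upSummand_eq_sum L v μ g DH hDHst α hαst Q hQ hQpair hQexh]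
  -- the summand, extended by `0` off the `G`-regular norm fibre so that it is stable UNCONDITIONALLY ((N5)'s `hF`)
  set F' : ((UnitaryGroup.cmDatum L 2 (Matrix.of fun i j : Fin 2 => if i.val + j.val + 1 = 2 then (1 : L) else 0)).Local v ×
      (UnitaryGroup.cmDatum L 1 (Matrix.of fun i j : Fin 1 => if i.val + j.val + 1 = 1 then (1 : L) else 0)).Local v) → ℂ :=
    fun a => if IsLocalGRegular L v a ∧ IsLocalNormPair L (qsForm L) v a g then
      finTau L v a μ * (DH a : ℂ) * ((finKappaAt L v (qsForm L) a g : ℤ) : ℂ) * α a else 0 with hF'def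
  have hreg : ∀ a b, IsLocalStablyConjH L v a b → IsLocalGRegular L v a → IsLocalGRegular L v b :=
    fun a b h ha => isLocalGRegular_of_isLocalStablyConjH L v ha h
  have hRst : ∀ a b (g' : Gqs L v), IsLocalStablyConjH L v a b → IsLocalNormPair L (qsForm L) v a g' → IsLocalNormPair L (qsForm L) v b g' :=
    fun a b g' h hR => (isLocalNormPair_iff_of_isLocalStablyConjH L v (qsForm L) h g').2 hR
  have hF' : ∀ a b, IsLocalStablyConjH L v a b → F' a = F' b := by
    intro a b h
    by_cases ha : IsLocalGRegular L v a ∧ IsLocalNormPair L (qsForm L) v a g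
    · have hb : IsLocalGRegular L v b ∧ IsLocalNormPair L (qsForm L) v b g := ⟨hreg a b h ha.1, hRst a b g h ha.2⟩
      simp only [hF'def, if_pos ha, if_pos hb]
      exact (upSummand_eq_of_isLocalStablyConjH L v μ g DH hDHst α hαst ha.1 h).symm
    · have hb : ¬ (IsLocalGRegular L v b ∧ IsLocalNormPair L (qsForm L) v b g) := fun hb =>
        ha ⟨hreg b a h.symm hb.1, hRst b a g h.symm hb.2⟩
      simp only [hF'def, if_neg ha, if_neg hb]
  -- ★ (N5) at the datum
  have key := Literature.GroupTheory.StableFibre.weighted_fibre_sum_eq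
    (G := Gqs L v)
    (IsLocalStablyConjH L v) (fun a => IsStablyConjH.refl _ _ _ a) (fun a b h => h.symm) (fun a b c h h' => h.trans h')
    (fun a b h => isStablyConjH_of_isConj h)
    (IsLocalGRegular L v) hreg
    (fun a g' => IsLocalNormPair L (qsForm L) v a g') hRst (fun a g₁ g₂ hg hR => isLocalNormPair_of_isConj_right L v a hg hR)
    SH (fun T => (T.subgroupOf (Subgroup.normalizer (T : Set ((UnitaryGroup.cmDatum L 2 (Matrix.of fun i j : Fin 2 => if i.val + j.val + 1 = 2 then (1 : L) else 0)).Local v ×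
          (UnitaryGroup.cmDatum L 1 (Matrix.of fun i j : Fin 1 => if i.val + j.val + 1 = 1 then (1 : L) else 0)).Local v)))).index) m n ψ
    hcomplete hirred
    (fun T hT s hs hsreg => by
      obtain ⟨γ₀, hγ₀, hTeq⟩ := hZ T hT
      exact exists_finset_mem_isConj_card_eq_index_centralizerH L v hns hγ₀ hTeq hs hsreg)
    hclasses hψR hψuniq g Q hQ
    (fun q hq q' hq' h => by
      by_contra hne
      exact hQpair q hq q' hq' hne h)
    hQexh fib hfib F' hF'
  beta_reduce at key
  -- undo the extension by `0`: on `Q` and on every `fib T i` the indicator is on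
  have hQF : ∑ q ∈ Q, F' q = ∑ q ∈ Q, finTau L v q μ * (DH q : ℂ) * ((finKappaAt L v (qsForm L) q g : ℤ) : ℂ) * α q :=
    Finset.sum_congr rfl fun q hq => by simp only [hF'def, if_pos (hQ q hq)]
  have hfibF : ∀ T ∈ SH, ∀ i : Fin (n T),
      ∑ x ∈ fib T i, F' x = ∑ x ∈ fib T i, finTau L v x μ * (DH x : ℂ) * ((finKappaAt L v (qsForm L) x g : ℤ) : ℂ) * α x := fun T hT i =>
    Finset.sum_congr rfl fun x hx => by
      obtain ⟨hxT, hxreg, hxconj⟩ := (hfib T hT i x).1 hx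
      have hxR : IsLocalNormPair L (qsForm L) v x g := isLocalNormPair_of_isConj_right L v x hxconj (hψR T hT i x hxT hxreg)
      simp only [hF'def, if_pos (And.intro hxreg hxR)]
  rw [← hQF, key]
  refine Finset.sum_congr rfl fun T hT => ?_
  rw [Finset.sum_congr rfl fun i _ => hfibF T hT i]

include hns hZ hcomplete hirred hclasses hψR hψuniq hfib in
/-- **(P3) — DATUM DRESS: `𝔇.up α g` on the H-Cartan re-parametrisation.**  Under UP-EVAL's pins of an `EllipticData` `𝔇` on `(U(Φ₃)(L⁺_v), H_v)` (`stConjH = ∼_st`, `G`-regular `⊆ regH`,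
`𝔇.DH` stable on `G`-regular classes, the (UP-DEF) field equation `hUp`), for a stable class function `α` on `regH` and a REGULAR `g`:
`𝔇.up α g = (𝔇.DG g)⁻¹ · Σ_{T ∈ SH} [N_H(T):T]⁻¹ · (m T)⁻¹ · Σ_i Σ_{x ∈ fib T i} τ(x)·𝔇.DH(x)·κ(x,g)·α(x)` — (A-1)+(A-2) of the road. [cite: Rogawski1990, §12.5 pp. 182–183, Lemma 12.5.1]
[cite: Rogawski1990, §4.9 p. 55] -/
theorem up_eq_weightedSum
    [MeasurableSpace (Gqs L v)] [∀ γ : Gqs L v, MeasurableSpace (Gqs L v ⧸ Subgroup.centralizer ({γ} : Set (Gqs L v)))]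
    [MeasurableSpace (Gqs L v ⧸ Subgroup.center (Gqs L v))]
    [MeasurableSpace ((UnitaryGroup.cmDatum L 2 (Matrix.of fun i j : Fin 2 => if i.val + j.val + 1 = 2 then (1 : L) else 0)).Local v ×
      (UnitaryGroup.cmDatum L 1 (Matrix.of fun i j : Fin 1 => if i.val + j.val + 1 = 1 then (1 : L) else 0)).Local v)]
    (𝔇 : Ch12Sec5.EllipticData (Gqs L v)
      ((UnitaryGroup.cmDatum L 2 (Matrix.of fun i j : Fin 2 => if i.val + j.val + 1 = 2 then (1 : L) else 0)).Local v ×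
        (UnitaryGroup.cmDatum L 1 (Matrix.of fun i j : Fin 1 => if i.val + j.val + 1 = 1 then (1 : L) else 0)).Local v))
    (hStH : ∀ a b, 𝔇.stConjH a b ↔ IsLocalStablyConjH L v a b)
    (hRegH : ∀ a, IsLocalGRegular L v a → a ∈ 𝔇.regH)
    (hDHst' : ∀ a b, IsLocalGRegular L v a → IsLocalStablyConjH L v a b → 𝔇.DH b = 𝔇.DH a)
    (hUp : ∀ (β : ((UnitaryGroup.cmDatum L 2 (Matrix.of fun i j : Fin 2 => if i.val + j.val + 1 = 2 then (1 : L) else 0)).Local v ×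
        (UnitaryGroup.cmDatum L 1 (Matrix.of fun i j : Fin 1 => if i.val + j.val + 1 = 1 then (1 : L) else 0)).Local v) → ℂ) (x : Gqs L v),
      𝔇.up β x =
        if IsRegularElt (x.val : GL (Fin 3) (UnitaryGroup.LocalRing L v)) then
          ((𝔇.DG x : ℂ))⁻¹ *
            ∑ᶠ q : Quot (IsLocalStablyConjH L v),
              (if IsLocalGRegular L v q.out ∧ IsLocalNormPair L (qsForm L) v q.out x then
                finTau L v q.out μ * (𝔇.DH q.out : ℂ) * ((finKappaAt L v (qsForm L) q.out x : ℤ) : ℂ) * β q.out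
              else 0)
        else 0)
    (hα : Ch12Sec5.IsStableClassFunOn 𝔇.stConjH 𝔇.regH α)
    (hg : IsRegularElt (g.val : GL (Fin 3) (UnitaryGroup.LocalRing L v))) :
    𝔇.up α g = ((𝔇.DG g : ℂ))⁻¹ *
      ∑ T ∈ SH, (((T.subgroupOf (Subgroup.normalizer (T : Set ((UnitaryGroup.cmDatum L 2 (Matrix.of fun i j : Fin 2 => if i.val + j.val + 1 = 2 then (1 : L) else 0)).Local v ×
          (UnitaryGroup.cmDatum L 1 (Matrix.of fun i j : Fin 1 => if i.val + j.val + 1 = 1 then (1 : L) else 0)).Local v)))).index : ℂ)⁻¹ * ((m T : ℂ))⁻¹) *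
        ∑ i : Fin (n T), ∑ x ∈ fib T i, finTau L v x μ * (𝔇.DH x : ℂ) * ((finKappaAt L v (qsForm L) x g : ℤ) : ℂ) * α x := by
  have hαst' : ∀ a b, IsLocalGRegular L v a → IsLocalStablyConjH L v a b → α b = α a :=
    fun a b ha h => hα.2 a (hRegH a ha) b ((hStH a b).2 h)
  rw [hUp, if_pos hg, finsum_upSummand_eq_weightedSum L v hns μ 𝔇.DH hDHst' α hαst' SH hZ hcomplete hirred m n ψ hclasses hψR hψuniq g fib hfib]

end ClaimP

end Summit.HodgeConjecture.HodgeConjecture.Cruxes.H413.F0P3cStCharTSUpTrClaimP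

end
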